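import Literature.Probability.TransportMaps.DobrushinCouplingCompact
import Literature.MathematicalPhysics.QuantumFieldTheory.Balaban1983to89.T4DobrushinTensorisation
import HarnessLib

/-!
# Dobrushin's coupling construction for finite-volume Gibbs laws (DLR instances of `OneSiteKernels`)

[topic Probability/TransportMaps]

The hypothesis structure `OneSiteKernels μ μ' γ γ' q` of
`Literature/Probability/TransportMaps/DobrushinCouplingCompact.lean` (Presutti 2009, §3.2.2
Thm. 3.2.2.1 for compact single-spin spaces [Presutti2009]) asks that `μ`, `μ'` be invariant under
resampling of one coordinate from the one-site kernels `γᵢ`, `γ'ᵢ` — «`μ_ω(i)` the conditional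
probability of `μ` given `ω(i)` … since `q` is a coupling of the conditional probabilities,
`Σ_{ω'} P(ω, ω') = μ(ω)`» — stated there for all measurable `f ≥ 0`. This file supplies that
hypothesis from the forms in which the tree states the DLR equations:

* `lintegral_lintegral_update_eq_of_forall_setLIntegral`: the SET form
  `∫ γ(ω)({t | ω[i↦t] ∈ A}) dμ(ω) = μ(A)` (the shape of
  `Literature.Probability.LatticeModels.IsGibbsMeasure`, Georgii 2011 Def. 1.23 / Rem. 1.24
  [Georgii2011]) implies the `lintegral` form; `OneSiteKernels.of_forall_setLIntegral`.
* `setLIntegral_eq_of_resamplingInvariant`: the Bochner form `ResamplingInvariant Q q` of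
  `…Balaban1983to89.T4DobrushinTensorisation` (bounded measurable real test functions) implies the
  set form; `OneSiteKernels.of_resamplingInvariant`.
* `oneSiteKernels_gibbs`: for bounded measurable energies `A`, `A'` on `ι → S` and a reference
  probability measure `ν` on `S`, the finite-volume Gibbs laws `gibbsMeasure (fun _ ↦ ν) A`,
  `gibbsMeasure (fun _ ↦ ν) A'` and their one-site Gibbs (heat-bath) kernels `gibbsKernel`
  (`T4DobrushinTensorisation` §7: `resamplingInvariant_gibbs` = the DLR identities on a finite
  product) satisfy `OneSiteKernels` for ANY measurable one-site couplings `q` with the right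
  marginals; hence `Presutti2009_thm_3_2_2_1_gibbs`: Presutti's Theorem 3.2.2.1 for two
  finite-volume Gibbs laws on a compact metric single-spin space (e.g. two lattice gauge actions on
  a finite set of links, `S = SU(N)`, `ν` = Haar).

Everything is proved; no definitions, no named facts.

## References
* E. Presutti, *Scaling Limits in Statistical Mechanics and Microstructures in Continuum Mechanics*,
  Springer 2009, §3.2.2. [Presutti2009]
* H.-O. Georgii, *Gibbs Measures and Phase Transitions*, 2nd ed., de Gruyter 2011, Def. 1.23,
  Rem. 1.24. [Georgii2011]
-/

noncomputable section

open MeasureTheory ProbabilityTheory Filter Function Finset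
open scoped ENNReal NNReal Topology BoundedContinuousFunction

namespace Literature.Probability.TransportMaps

namespace DobrushinCouplingGibbs

open Literature.MeasureTheory.OptimalTransport (IsCoupling)
open Literature.Probability.TransportMaps.DobrushinCouplingCompact
open Literature.MathematicalPhysics.QuantumFieldTheory.Balaban1983to89.T4DobrushinTensorisation
  (ResamplingInvariant gibbsMeasure gibbsKernel isMarkovKernel_gibbsKernel
    isProbabilityMeasure_gibbsMeasure resamplingInvariant_gibbs)

variable {ι : Type*} [DecidableEq ι]
variable {S : Type*} [MeasurableSpace S]

/-! ### From the set form of the one-site DLR equation -/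

/-- **Resampling invariance from its set form.** If `∫ γ(ω)({t | ω[i↦t] ∈ A}) dμ(ω) = μ(A)` for
every measurable `A` (the DLR equation for the volume `{i}`, Georgii 2011 Rem. 1.24), then
`∫∫ f(ω[i↦t]) dγ(ω)(t) dμ(ω) = ∫ f dμ` for every measurable `f ≥ 0` (both sides are the integral
of `f` against `(μ ⊗ γ) ∘ (ω, t ↦ ω[i↦t])⁻¹`, which the set form identifies with `μ`).
[cite: Georgii2011, Def. 1.23 / Rem. 1.24] -/
theorem lintegral_lintegral_update_eq_of_forall_setLIntegral (γ : Kernel (ι → S) S)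
    [IsMarkovKernel γ] (μ : Measure (ι → S)) [SFinite μ] (i : ι)
    (hset : ∀ A : Set (ι → S), MeasurableSet A → ∫⁻ ω, γ ω ((update ω i) ⁻¹' A) ∂μ = μ A)
    (f : (ι → S) → ℝ≥0∞) (hf : Measurable f) :
    ∫⁻ ω, ∫⁻ t, f (update ω i t) ∂(γ ω) ∂μ = ∫⁻ ω, f ω ∂μ := by
  have hu : Measurable fun p : (ι → S) × S => update p.1 i p.2 := measurable_update'
  have hmap : (μ ⊗ₘ γ).map (fun p : (ι → S) × S => update p.1 i p.2) = μ := by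
    ext A hA
    rw [Measure.map_apply hu hA, ← lintegral_indicator_one (hu hA),
      Measure.lintegral_compProd (measurable_one.indicator (hu hA)), ← hset A hA]
    refine lintegral_congr fun ω => ?_
    rw [← lintegral_indicator_one (measurable_update _ hA)]
    exact lintegral_congr fun t => rfl
  calc ∫⁻ ω, ∫⁻ t, f (update ω i t) ∂(γ ω) ∂μ
      = ∫⁻ p, f (update p.1 i p.2) ∂(μ ⊗ₘ γ) :=
        (Measure.lintegral_compProd (f := fun p : (ι → S) × S => f (update p.1 i p.2))
          (hf.comp hu)).symm
    _ = ∫⁻ ω, f ω ∂((μ ⊗ₘ γ).map fun p : (ι → S) × S => update p.1 i p.2) :=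
        (lintegral_map hf hu).symm
    _ = ∫⁻ ω, f ω ∂μ := by rw [hmap]

variable {μ μ' : Measure (ι → S)} {γ γ' : ι → Kernel (ι → S) S}
  {q : ι → Kernel ((ι → S) × (ι → S)) (S × S)}

/-- **`OneSiteKernels` from the set form of the one-site DLR equations** and the marginal
conditions on the couplings `qᵢ`. [cite: Presutti2009, §3.2.2 «The setup»] -/
theorem OneSiteKernels.of_forall_setLIntegral [Fintype ι] [∀ i, IsMarkovKernel (γ i)]
    [∀ i, IsMarkovKernel (γ' i)] [SFinite μ] [SFinite μ']
    (hμ : ∀ i (A : Set (ι → S)), MeasurableSet A → ∫⁻ ω, γ i ω ((update ω i) ⁻¹' A) ∂μ = μ A)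
    (hμ' : ∀ i (A : Set (ι → S)), MeasurableSet A →
      ∫⁻ ω', γ' i ω' ((update ω' i) ⁻¹' A) ∂μ' = μ' A)
    (hfst : ∀ i p, (q i p).map Prod.fst = γ i p.1) (hsnd : ∀ i p, (q i p).map Prod.snd = γ' i p.2) :
    OneSiteKernels μ μ' γ γ' q :=
  ⟨fun i f hf => lintegral_lintegral_update_eq_of_forall_setLIntegral (γ i) μ i (hμ i) f hf,
    fun i f hf => lintegral_lintegral_update_eq_of_forall_setLIntegral (γ' i) μ' i (hμ' i) f hf,
    hfst, hsnd⟩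

/-! ### From `ResamplingInvariant` (bounded measurable real test functions) -/

/-- **The set form from `ResamplingInvariant`**: testing the resampling invariance of `Q` under
the one-site kernels `kᵢ` on indicators gives `∫ kᵢ(ξ)({y | ξ[i↦y] ∈ A}) dQ(ξ) = Q(A)`.
[cite: Georgii2011, Def. 1.23 / Rem. 1.24] -/
theorem setLIntegral_eq_of_resamplingInvariant [Fintype ι] {Q : Measure (ι → S)}
    [IsProbabilityMeasure Q] {k : (i : ι) → Kernel (ι → S) S} [∀ i, IsMarkovKernel (k i)]
    (hinv : ResamplingInvariant (E := fun _ : ι => S) Q k) (i : ι) (A : Set (ι → S))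
    (hA : MeasurableSet A) :
    ∫⁻ ξ, k i ξ ((update ξ i) ⁻¹' A) ∂Q = Q A := by
  -- test `ResamplingInvariant` on the indicator of `A`
  have h := hinv i (A.indicator 1) 1 (measurable_one.indicator hA) fun ξ => by
    by_cases hξ : ξ ∈ A <;> simp [Set.indicator, hξ]
  have hinner : ∀ ξ : ι → S, ∫ y, A.indicator (1 : (ι → S) → ℝ) (update ξ i y) ∂(k i ξ) =
      (k i ξ).real ((update ξ i) ⁻¹' A) := fun ξ => by
    rw [← integral_indicator_one (measurable_update _ hA)]
    exact integral_congr_ae (Eventually.of_forall fun y => rfl)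
  simp_rw [hinner, integral_indicator_one hA] at h
  -- convert the Bochner identity to an identity in `ℝ≥0∞`
  have hmeas : Measurable fun ξ : ι → S => k i ξ ((update ξ i) ⁻¹' A) := by
    have : (fun ξ : ι → S => k i ξ ((update ξ i) ⁻¹' A)) =
        fun ξ => ∫⁻ y, A.indicator (1 : (ι → S) → ℝ≥0∞) (update ξ i y) ∂(k i ξ) := by
      funext ξ
      rw [← lintegral_indicator_one (measurable_update _ hA)]
      exact lintegral_congr fun y => rfl
    rw [this]
    exact Measurable.lintegral_kernel_prod_right
      (f := fun (ξ : ι → S) (y : S) => A.indicator (1 : (ι → S) → ℝ≥0∞) (update ξ i y))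
      ((measurable_one.indicator hA).comp measurable_update')
  have hle : ∫⁻ ξ, k i ξ ((update ξ i) ⁻¹' A) ∂Q ≤ 1 := by
    calc ∫⁻ ξ, k i ξ ((update ξ i) ⁻¹' A) ∂Q ≤ ∫⁻ _, 1 ∂Q := lintegral_mono fun ξ => prob_le_one
      _ = 1 := by rw [lintegral_const, measure_univ, mul_one]
  have hfin : ∫⁻ ξ, k i ξ ((update ξ i) ⁻¹' A) ∂Q ≠ ⊤ := ne_top_of_le_ne_top ENNReal.one_ne_top hle
  rw [← ENNReal.toReal_eq_toReal_iff' hfin (measure_ne_top Q A), ← integral_toReal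
    hmeas.aemeasurable (Eventually.of_forall fun ξ => prob_le_one.trans_lt ENNReal.one_lt_top)]
  exact h

/-- **`OneSiteKernels` from `ResamplingInvariant`** (for `μ` w.r.t. `γ` and `μ'` w.r.t. `γ'`) and
the marginal conditions on the couplings. [cite: Presutti2009, §3.2.2 «The setup»] -/
theorem OneSiteKernels.of_resamplingInvariant [Fintype ι] [IsProbabilityMeasure μ]
    [IsProbabilityMeasure μ'] [∀ i, IsMarkovKernel (γ i)] [∀ i, IsMarkovKernel (γ' i)]
    (hμ : ResamplingInvariant (E := fun _ : ι => S) μ γ)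
    (hμ' : ResamplingInvariant (E := fun _ : ι => S) μ' γ')
    (hfst : ∀ i p, (q i p).map Prod.fst = γ i p.1) (hsnd : ∀ i p, (q i p).map Prod.snd = γ' i p.2) :
    OneSiteKernels μ μ' γ γ' q :=
  OneSiteKernels.of_forall_setLIntegral (setLIntegral_eq_of_resamplingInvariant hμ)
    (setLIntegral_eq_of_resamplingInvariant hμ') hfst hsnd

/-! ### Finite-volume Gibbs laws of bounded energies -/

section Gibbs

variable [Fintype ι] (ν : Measure S) [IsProbabilityMeasure ν] {A A' : (ι → S) → ℝ}

/-- **Finite-volume Gibbs laws satisfy `OneSiteKernels` with their heat-bath kernels.** For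
bounded measurable energies `A`, `A'` on `ι → S` and a reference probability measure `ν` on `S`,
the Gibbs laws `exp(−A) dν^⊗ι / Z`, `exp(−A') dν^⊗ι / Z'` (`gibbsMeasure`) are invariant under
their one-site Gibbs kernels (`gibbsKernel`; `resamplingInvariant_gibbs` — the DLR identities on
a finite product), so any MEASURABLE one-site couplings `qᵢ` of `γᵢ(·|ω)`, `γ'ᵢ(·|ω')` are
admissible data for Theorem 3.2.2.1. [cite: Presutti2009, §3.2.2 «The setup»] -/
theorem oneSiteKernels_gibbs (hAm : Measurable A) {a : ℝ} (hAb : ∀ ξ, |A ξ| ≤ a)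
    (hA'm : Measurable A') {a' : ℝ} (hA'b : ∀ ξ, |A' ξ| ≤ a')
    [∀ i, IsMarkovKernel (gibbsKernel (E := fun _ : ι => S) (fun _ => ν) A i)]
    [∀ i, IsMarkovKernel (gibbsKernel (E := fun _ : ι => S) (fun _ => ν) A' i)]
    (hfst : ∀ i p, (q i p).map Prod.fst = gibbsKernel (E := fun _ : ι => S) (fun _ => ν) A i p.1)
    (hsnd : ∀ i p, (q i p).map Prod.snd = gibbsKernel (E := fun _ : ι => S) (fun _ => ν) A' i p.2) :
    OneSiteKernels (gibbsMeasure (E := fun _ : ι => S) (fun _ => ν) A)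
      (gibbsMeasure (E := fun _ : ι => S) (fun _ => ν) A')
      (gibbsKernel (E := fun _ : ι => S) (fun _ => ν) A)
      (gibbsKernel (E := fun _ : ι => S) (fun _ => ν) A') q := by
  haveI := isProbabilityMeasure_gibbsMeasure (π := fun _ : ι => ν) hAm hAb
  haveI := isProbabilityMeasure_gibbsMeasure (π := fun _ : ι => ν) hA'm hA'b
  exact OneSiteKernels.of_resamplingInvariant
    (resamplingInvariant_gibbs (π := fun _ : ι => ν) hAm hAb)
    (resamplingInvariant_gibbs (π := fun _ : ι => ν) hA'm hA'b) hfst hsnd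

variable [MetricSpace S] [CompactSpace S] [BorelSpace S] [Nonempty ι]

/-- **Presutti 2009, Theorem 3.2.2.1, for two finite-volume Gibbs laws on a compact metric
single-spin space.** Sites `ι` finite, `S` compact metric (Borel), reference probability measure
`ν` on `S`, bounded measurable energies `A`, `A'`; `μ = e^{−A} ν^⊗ι/Z`, `μ' = e^{−A'} ν^⊗ι/Z'`
with one-site Gibbs kernels `γᵢ`, `γ'ᵢ`; MEASURABLE one-site couplings `qᵢ(ω, ω')` of
`γᵢ(·|ω)`, `γ'ᵢ(·|ω')` (Markov kernels); bounded continuous site costs `dᵢ` and bounds `Kᵢ` with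
`∫ dᵢ dqᵢ(ω, ω') ≤ Kᵢ(ω, ω')` ((3.2.2.2)). THEN there is a coupling `Q` of `μ`, `μ'` with
`∫ dᵢ(ωᵢ, ω'ᵢ) dQ ≤ ∫ Kᵢ dQ` for every `i` ((3.2.2.3)). (E.g. two lattice gauge actions on a
finite set of links, `S = SU(N)`, `ν` = Haar measure.)
[cite: Presutti2009, §3.2.2 Thm. 3.2.2.1] -/
theorem Presutti2009_thm_3_2_2_1_gibbs (hAm : Measurable A) {a : ℝ} (hAb : ∀ ξ, |A ξ| ≤ a)
    (hA'm : Measurable A') {a' : ℝ} (hA'b : ∀ ξ, |A' ξ| ≤ a') [∀ i, IsMarkovKernel (q i)]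
    (hfst : ∀ i p, (q i p).map Prod.fst = gibbsKernel (E := fun _ : ι => S) (fun _ => ν) A i p.1)
    (hsnd : ∀ i p, (q i p).map Prod.snd = gibbsKernel (E := fun _ : ι => S) (fun _ => ν) A' i p.2)
    (d : ι → (S × S) →ᵇ ℝ≥0) (K : ι → ((ι → S) × (ι → S)) →ᵇ ℝ≥0)
    (hdK : ∀ i p, ∫⁻ s, (d i s : ℝ≥0∞) ∂(q i p) ≤ K i p) :
    ∃ Q : Measure ((ι → S) × (ι → S)), IsProbabilityMeasure Q ∧
      IsCoupling (gibbsMeasure (E := fun _ : ι => S) (fun _ => ν) A)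
        (gibbsMeasure (E := fun _ : ι => S) (fun _ => ν) A') Q ∧
      ∀ i, ∫⁻ x, (d i (x.1 i, x.2 i) : ℝ≥0∞) ∂Q ≤ ∫⁻ x, (K i x : ℝ≥0∞) ∂Q := by
  haveI := fun i => isMarkovKernel_gibbsKernel (π := fun _ : ι => ν) hAm hAb i
  haveI := fun i => isMarkovKernel_gibbsKernel (π := fun _ : ι => ν) hA'm hA'b i
  haveI := isProbabilityMeasure_gibbsMeasure (π := fun _ : ι => ν) hAm hAb
  haveI := isProbabilityMeasure_gibbsMeasure (π := fun _ : ι => ν) hA'm hA'b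
  exact Presutti2009_thm_3_2_2_1_compact (oneSiteKernels_gibbs ν hAm hAb hA'm hA'b hfst hsnd)
    d K hdK

end Gibbs

end DobrushinCouplingGibbs

end Literature.Probability.TransportMaps

end
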